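import Literature.Algebra.Homology.OrderedCechPairSystemCrossMap
import Literature.Algebra.Homology.OrderedCechPairSystemShuffleMap
import Literature.Algebra.Homology.OrderedCechShuffleCoefficientStaircase
import HarnessLib

/-!
# The Eilenberg–Zilber retraction on the ordered Čech bicomplex of a pair-system: `× ≫ ∇ = 𝟙` (Eilenberg–Mac Lane 1953 §5;
# The Stacks Project, Tag 0BEC)

Layer `Literature/Algebra/Homology`, PROOF lane (theorems only; no definition, no instance, no notation, no named fact).  For a pair-system
`P : Finset ι ⥤ Finset κ ⥤ ModuleCat A`, the cross product `× : Tot Č•,•(P) ⟶ Č(lexSystem P)` (`Algebra/Homology/OrderedCechPairSystemCrossMap`)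
followed by the shuffle map `∇ : Č(lexSystem P) ⟶ Tot Č•,•(P)` (`Algebra/Homology/OrderedCechPairSystemShuffleMap`) is the IDENTITY of the
total complex: **`cross_shuffle`**.  Componentwise (§3): `∇_{a',b'} (×_{a,b} x) = [a' = a] x` (`shuffleComponent_crossComponent_self`,
`shuffleComponent_crossComponent_of_ne`).  The computation (§1–§2): `(× x)` read in the rectangle `σ × τ` along `T ⊆ σ × τ` is the double
alternating reading of `x` at the front `π₁`-word / back `π₂`-word of `T`; it vanishes unless both words are injective with images `σ`,
`τ` — which forces `a' = a` and the whole last column `{max σ} × τ ⊆ T` — and then the shuffle coefficient kills every such `T` except the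
staircase `(σ × {min τ}) ∪ ({max σ} × τ)` (`Algebra/Homology/OrderedCechShuffleCoefficientStaircase`), on which `× x` reads `x(τ)(σ)` with
coefficient `+1`.  Consequence for the Künneth packet: `H(×)` is injective (a retract), hence bijective once `Hⁿ(Tot) ≅ Hⁿ(Č(lexSystem P))`
abstractly and the modules are finite (cell consumer F-K3).

Cell `hodgecm-mathlib` (D-0151), F-11 / J3 Künneth packet, brick (K2-c-3) of F0P1b-p04's plan (RULINGS #3 (R15), #4 (R20)).  HC_CM is proved only modulo
the 7 printed citations until rung 0 closes — nothing here bears on a summit statement.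

## References
* S. Eilenberg, S. Mac Lane, *On the groups `H(Π,n)`, I*, Ann. of Math. 58 (1953), §5 (`∇`, `f × g`, and `∇ ∘ ×`). [EilenbergMacLane1953]
* The Stacks Project, Tag 0BEC, Tag 012K, Tag 01FG. [StacksProject]
* U. Görtz, T. Wedhorn, *Algebraic Geometry II* (2023), Def. 21.64, Def. 21.68 (pp. 179–180). [GortzWedhorn2023]
-/

universe u

open CategoryTheory CategoryTheory.Limits HomologicalComplex

set_option backward.isDefEq.respectTransparency false

noncomputable section

namespace Literature.Algebra.Homology

namespace OrderedCech

variable {A : Type u} [CommRing A] {ι κ : Type} [LinearOrder ι] [LinearOrder κ]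
  {P : Finset ι ⥤ Finset κ ⥤ ModuleCat.{u} A}

/-! ### §1 Reading the cross product inside a rectangle -/

omit [CommRing A] in
/-- In the lexicographic order, vertices with equal first coordinates compare by the second. [cite: StacksProject, Tag 0BEC] -/
theorem snd_le_of_le_of_fst_eq {w w' : ι ×ₗ κ} (h : w ≤ w') (h1 : (ofLex w).1 = (ofLex w').1) :
    (ofLex w).2 ≤ (ofLex w').2 := by
  rcases (Prod.Lex.le_iff (x := ofLex w) (y := ofLex w')).1 h with h2 | ⟨-, h2⟩
  · exact absurd h1 (ne_of_lt h2)
  · exact h2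

/-- `(× x)` read in `σ × τ` along `T ⊆ σ × τ` with `#T = a+b+1` is the double reading of `x` at the front/back words of `T`.
[cite: EilenbergMacLane1953, §5] -/
theorem boxEval_crossComponent (a b : ℕ) (x : SysCochain (cochainSystem P a) b) (σ : Finset ι) (τ : Finset κ)
    {T : Finset (ι ×ₗ κ)} (hT : fstProj T ⊆ σ ∧ sndProj T ⊆ τ) (hc : T.card = a + b + 1) :
    (crossComponent P a b ((a : ℤ) + b) x).boxEval σ τ T = x.crossRead (frontWord T hc) (backWord T hc) σ τ := by
  have hTs : T.Nonempty ∧ ((T.card : ℤ)) = (a : ℤ) + b + 1 := ⟨Finset.card_pos.mp (by omega), by rw [hc]; push_cast; ring⟩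
  have hr : 0 ≤ (a : ℤ) ∧ 0 ≤ (b : ℤ) ∧ (a : ℤ) + b = (a : ℤ) + b := ⟨by omega, by omega, rfl⟩
  rw [SysCochain.boxEval_eq _ ⟨T, hTs⟩ hT.1 hT.2, crossComponent_apply_of P hr]
  exact SysCochain.pairRestrict_crossRead x _ _ _ _ (image_frontWord_subset _ _) (image_backWord_subset _ _)

/-- … and it vanishes along `T` of any other cardinality. [cite: EilenbergMacLane1953, §5] -/
theorem boxEval_crossComponent_of_card_ne (a b : ℕ) (x : SysCochain (cochainSystem P a) b) (σ : Finset ι) (τ : Finset κ)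
    {T : Finset (ι ×ₗ κ)} (hc : T.card ≠ a + b + 1) : (crossComponent P a b ((a : ℤ) + b) x).boxEval σ τ T = 0 :=
  SysCochain.boxEval_eq_zero _ fun h => hc (by have := h.1.2; omega)

/-- **What a non-zero double reading forces**: both words injective, their letter sets an `a`- resp. `b`-simplex inside `s` resp. `t`.
[cite: EilenbergMacLane1953, §5] [cite: StacksProject, Tag 01FG] -/
theorem crossRead_ne_zero_imp {a b : ℤ} (x : SysCochain (cochainSystem P a) b) {p q : ℕ} (α : Fin p → ι) (β : Fin q → κ)
    (s : Finset ι) (t : Finset κ) (h : x.crossRead α β s t ≠ 0) :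
    Function.Injective α ∧ Function.Injective β ∧
      ((Finset.univ.image α).Nonempty ∧ (((Finset.univ.image α).card : ℤ)) = a + 1) ∧ Finset.univ.image α ⊆ s ∧
      ((Finset.univ.image β).Nonempty ∧ (((Finset.univ.image β).card : ℤ)) = b + 1) ∧ Finset.univ.image β ⊆ t := by
  classical
  unfold SysCochain.crossRead at h
  by_cases hα : Function.Injective α
  swap
  · exact absurd (SysCochain.altEvalAt_of_not_injective _ hα _) h
  rw [SysCochain.altEvalAt_of_injective _ hα] at h
  have h1 : SysCochain.ext0At (M := P.flip.obj t) (x.altEvalAt β t) (Finset.univ.image α) s ≠ 0 :=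
    fun h0 => h (by rw [h0, smul_zero])
  unfold SysCochain.ext0At at h1
  by_cases hc : ((Finset.univ.image α).Nonempty ∧ (((Finset.univ.image α).card : ℤ)) = a + 1) ∧ Finset.univ.image α ⊆ s
  swap
  · exact absurd (dif_neg hc) h1
  rw [dif_pos hc] at h1
  have h2 : x.altEvalAt β t ≠ 0 := by
    intro h0
    apply h1
    rw [h0]
    exact map_zero _
  by_cases hβ : Function.Injective β
  swap
  · exact absurd (SysCochain.altEvalAt_of_not_injective _ hβ _) h2
  rw [SysCochain.altEvalAt_of_injective _ hβ] at h2
  have h3 : x.ext0At (Finset.univ.image β) t ≠ 0 := fun h0 => h2 (by rw [h0, smul_zero])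
  unfold SysCochain.ext0At at h3
  by_cases hc' : ((Finset.univ.image β).Nonempty ∧ (((Finset.univ.image β).card : ℤ)) = b + 1) ∧ Finset.univ.image β ⊆ t
  swap
  · exact absurd (dif_neg hc') h3
  exact ⟨hα, hβ, hc.1, hc.2, hc'.1, hc'.2⟩

/-! ### §2 Along which `T` the reading survives: the last column, and the staircase -/

/-- **A surviving reading contains the last column.**  For `σ` an `a`-simplex, `τ` a `b`-simplex and `T ⊆ σ × τ` with `#T = a+b+1`: if
`x` read along `T` is non-zero then the front word of `T` enumerates `σ` (so ends at `max σ`), every later vertex of `T` sits in the column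
`max σ`, and the back word enumerates `τ` — hence `{max σ} × τ ⊆ T` and the reading is `x(τ)(σ)`. [cite: EilenbergMacLane1953, §5] -/
theorem column_subset_of_crossRead_ne_zero (a b : ℕ) (x : SysCochain (cochainSystem P a) b) (σ : Simplex ι a)
    (τ : Simplex κ b) {T : Finset (ι ×ₗ κ)} (hT : fstProj T ⊆ σ.1 ∧ sndProj T ⊆ τ.1) (hc : T.card = a + b + 1)
    (h : x.crossRead (frontWord T hc) (backWord T hc) σ.1 τ.1 ≠ 0) :
    (∀ j ∈ τ.1, toLex (σ.1.max' σ.2.1, j) ∈ T) ∧ x.crossRead (frontWord T hc) (backWord T hc) σ.1 τ.1 = x τ σ := by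
  obtain ⟨hαi, hβi, ⟨-, hαc⟩, hαs, ⟨-, hβc⟩, hβt⟩ := crossRead_ne_zero_imp x _ _ _ _ h
  have hσ : σ.1.card = a + 1 := by have := σ.2.2; omega
  have hτ : τ.1.card = b + 1 := by have := τ.2.2; omega
  have himα : Finset.univ.image (frontWord T hc) = σ.1 :=
    Finset.eq_of_subset_of_card_le hαs (by have := σ.2.2; omega)
  have himβ : Finset.univ.image (backWord T hc) = τ.1 :=
    Finset.eq_of_subset_of_card_le hβt (by have := τ.2.2; omega)
  set e := T.orderEmbOfFin hc with he
  -- the front word is the sorted enumeration of `σ`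
  have hfmono : StrictMono (frontWord T hc) := by
    refine Monotone.strictMono_of_injective (fun k k' hkk' => ?_) hαi
    exact fst_le_of_le (e.monotone (Fin.le_def.mpr (by simpa using hkk')))
  have hfw : frontWord T hc = ⇑(σ.1.orderEmbOfFin hσ) :=
    Finset.orderEmbOfFin_unique hσ (fun k => himα ▸ Finset.mem_image_of_mem _ (Finset.mem_univ k)) hfmono
  have hlast : (ofLex (e ⟨a, by omega⟩)).1 = σ.1.max' σ.2.1 := by
    have h1 : frontWord T hc ⟨a, by omega⟩ = σ.1.orderEmbOfFin hσ ⟨a + 1 - 1, by omega⟩ := by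
      rw [hfw]; congr 1
    rw [Finset.orderEmbOfFin_last hσ (by omega)] at h1
    exact h1
  -- every later vertex sits in the column `max σ`
  have hcol : ∀ m : Fin (b + 1), (ofLex (e ⟨a + m, by omega⟩)).1 = σ.1.max' σ.2.1 := by
    intro m
    refine le_antisymm (Finset.le_max' _ _ (hT.1 (fst_mem_fstProj (Finset.orderEmbOfFin_mem T hc _)))) ?_
    rw [← hlast]
    exact fst_le_of_le (e.monotone (Fin.le_def.mpr (by simp)))
  -- the back word is the sorted enumeration of `τ`
  have hbmono : StrictMono (backWord T hc) := by
    refine Monotone.strictMono_of_injective (fun m m' hmm' => ?_) hβi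
    have hle : e ⟨a + m, by omega⟩ ≤ e ⟨a + m', by omega⟩ := e.monotone (Fin.le_def.mpr (by simpa using hmm'))
    exact snd_le_of_le_of_fst_eq hle (by rw [hcol m, hcol m'])
  have hbw : backWord T hc = ⇑(τ.1.orderEmbOfFin hτ) :=
    Finset.orderEmbOfFin_unique hτ (fun k => himβ ▸ Finset.mem_image_of_mem _ (Finset.mem_univ k)) hbmono
  refine ⟨fun j hj => ?_, ?_⟩
  · rw [← himβ] at hj
    obtain ⟨m, -, rfl⟩ := Finset.mem_image.mp hj
    have hv : toLex (σ.1.max' σ.2.1, backWord T hc m) = e ⟨a + m, by omega⟩ := by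
      rw [← toLex_ofLex (e ⟨a + m, by omega⟩)]
      exact congrArg toLex (Prod.ext (hcol m).symm rfl)
    rw [hv]
    exact Finset.orderEmbOfFin_mem T hc _
  · unfold SysCochain.crossRead
    rw [SysCochain.altEvalAt_of_strictMono _ hfmono, himα, SysCochain.altEvalAt_of_strictMono _ hbmono, himβ,
      SysCochain.ext0At_self (M := cochainSystem P a) x τ]
    exact SysCochain.ext0At_self (M := P.flip.obj τ.1) (x τ) σ

/-- The staircase lies in the rectangle. [cite: EilenbergMacLane1953, §5] -/
theorem staircase_subset_box (σ : Finset ι) (τ : Finset κ) (hσ : σ.Nonempty) (hτ : τ.Nonempty) :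
    fstProj (((σ ×ˢ ({τ.min' hτ} : Finset κ)) ∪ (({σ.max' hσ} : Finset ι) ×ˢ τ)).image toLex) ⊆ σ ∧
      sndProj (((σ ×ˢ ({τ.min' hτ} : Finset κ)) ∪ (({σ.max' hσ} : Finset ι) ×ˢ τ)).image toLex) ⊆ τ := by
  refine subset_image_toLex_iff.mp fun w hw => mem_image_toLex.mpr ?_
  rcases mem_staircase.mp hw with ⟨h1, h2⟩ | ⟨h1, h2⟩
  · exact ⟨h1, h2 ▸ τ.min'_mem hτ⟩
  · exact ⟨h1 ▸ σ.max'_mem hσ, h2⟩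

/-- The staircase has `#σ + #τ - 1` vertices. [cite: EilenbergMacLane1953, §5] -/
theorem card_staircase (σ : Finset ι) (τ : Finset κ) (hσ : σ.Nonempty) (hτ : τ.Nonempty) :
    (((σ ×ˢ ({τ.min' hτ} : Finset κ)) ∪ (({σ.max' hσ} : Finset ι) ×ˢ τ)).image toLex).card + 1 = σ.card + τ.card := by
  rw [Finset.card_image_of_injective _ toLex.injective]
  have h := Finset.card_union_add_card_inter (σ ×ˢ ({τ.min' hτ} : Finset κ)) (({σ.max' hσ} : Finset ι) ×ˢ τ)
  rw [Finset.product_inter_product, Finset.inter_singleton_of_mem (σ.max'_mem hσ),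
    Finset.singleton_inter_of_mem (τ.min'_mem hτ), Finset.card_product, Finset.card_product, Finset.card_product] at h
  simp only [Finset.card_singleton] at h
  omega

/-- **The sorted enumeration of the staircase**: first along `σ` at height `min τ`, then up the column `max σ`.
[cite: EilenbergMacLane1953, §5] -/
theorem orderEmbOfFin_staircase {a b : ℕ} (σ : Simplex ι a) (τ : Simplex κ b) (hσ : σ.1.card = a + 1) (hτ : τ.1.card = b + 1)
    (hc : (((σ.1 ×ˢ ({τ.1.min' τ.2.1} : Finset κ)) ∪ (({σ.1.max' σ.2.1} : Finset ι) ×ˢ τ.1)).image toLex).card = a + b + 1) :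
    ⇑((((σ.1 ×ˢ ({τ.1.min' τ.2.1} : Finset κ)) ∪ (({σ.1.max' σ.2.1} : Finset ι) ×ˢ τ.1)).image toLex).orderEmbOfFin hc) =
      fun k : Fin (a + b + 1) => if hk : (k : ℕ) ≤ a then toLex (σ.1.orderEmbOfFin hσ ⟨k, by omega⟩, τ.1.min' τ.2.1)
        else toLex (σ.1.max' σ.2.1, τ.1.orderEmbOfFin hτ ⟨k - a, by omega⟩) := by
  symm
  have hmaxσ : σ.1.orderEmbOfFin hσ ⟨a, by omega⟩ = σ.1.max' σ.2.1 := by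
    rw [← Finset.orderEmbOfFin_last hσ (by omega)]; congr 1
  have hminτ : τ.1.orderEmbOfFin hτ ⟨0, by omega⟩ = τ.1.min' τ.2.1 := Finset.orderEmbOfFin_zero hτ (by omega)
  refine Finset.orderEmbOfFin_unique hc (fun k => ?_) ?_
  · -- membership
    by_cases hk : (k : ℕ) ≤ a
    · rw [dif_pos hk, mem_staircase]
      exact Or.inl ⟨Finset.orderEmbOfFin_mem _ _ _, rfl⟩
    · rw [dif_neg hk, mem_staircase]
      exact Or.inr ⟨rfl, Finset.orderEmbOfFin_mem _ _ _⟩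
  · -- strictly increasing in the lexicographic order
    intro k k' hkk'
    have hlt : (k : ℕ) < k' := hkk'
    dsimp only
    by_cases hk : (k : ℕ) ≤ a <;> by_cases hk' : (k' : ℕ) ≤ a
    · rw [dif_pos hk, dif_pos hk']
      exact Prod.Lex.lt_iff.mpr (Or.inl ((σ.1.orderEmbOfFin hσ).strictMono (Fin.lt_def.mpr (by simpa using hlt))))
    · rw [dif_pos hk, dif_neg hk']
      rcases (Nat.lt_or_eq_of_le hk) with hka | hka
      · refine Prod.Lex.lt_iff.mpr (Or.inl ?_)
        rw [← hmaxσ]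
        exact (σ.1.orderEmbOfFin hσ).strictMono (Fin.lt_def.mpr (by simpa using hka))
      · refine Prod.Lex.lt_iff.mpr (Or.inr ⟨?_, ?_⟩)
        · change σ.1.orderEmbOfFin hσ ⟨k, _⟩ = σ.1.max' σ.2.1
          rw [← hmaxσ]; congr 1; exact Fin.ext hka
        · change τ.1.min' τ.2.1 < τ.1.orderEmbOfFin hτ ⟨k' - a, _⟩
          rw [← hminτ]
          exact (τ.1.orderEmbOfFin hτ).strictMono (Fin.lt_def.mpr (by simp; omega))
    · exact absurd (le_trans hlt.le hk') hk
    · rw [dif_neg hk, dif_neg hk']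
      refine Prod.Lex.lt_iff.mpr (Or.inr ⟨rfl, ?_⟩)
      exact (τ.1.orderEmbOfFin hτ).strictMono (Fin.lt_def.mpr (by simp; omega))

/-- **The cross product read along the staircase is `x(τ)(σ)`** (front word = `σ` in order, back word = `τ` in order).
[cite: EilenbergMacLane1953, §5] -/
theorem boxEval_crossComponent_staircase (a b : ℕ) (x : SysCochain (cochainSystem P a) b) (σ : Simplex ι a)
    (τ : Simplex κ b) :
    (crossComponent P a b ((a : ℤ) + b) x).boxEval σ.1 τ.1
      (((σ.1 ×ˢ ({τ.1.min' τ.2.1} : Finset κ)) ∪ (({σ.1.max' σ.2.1} : Finset ι) ×ˢ τ.1)).image toLex) = x τ σ := by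
  have hσ : σ.1.card = a + 1 := by have := σ.2.2; omega
  have hτ : τ.1.card = b + 1 := by have := τ.2.2; omega
  have hc : (((σ.1 ×ˢ ({τ.1.min' τ.2.1} : Finset κ)) ∪ (({σ.1.max' σ.2.1} : Finset ι) ×ˢ τ.1)).image toLex).card = a + b + 1 := by
    have := card_staircase σ.1 τ.1 σ.2.1 τ.2.1; omega
  rw [boxEval_crossComponent a b x σ.1 τ.1 (staircase_subset_box σ.1 τ.1 σ.2.1 τ.2.1) hc]
  have hE := orderEmbOfFin_staircase σ τ hσ hτ hc
  have hfw : frontWord _ hc = ⇑(σ.1.orderEmbOfFin hσ) := by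
    funext k
    unfold frontWord
    rw [hE]
    dsimp only
    rw [dif_pos (by have := k.2; omega)]
    rfl
  have hbw : backWord _ hc = ⇑(τ.1.orderEmbOfFin hτ) := by
    funext m
    unfold backWord
    rw [hE]
    dsimp only
    by_cases hm : (m : ℕ) = 0
    · rw [dif_pos (by omega)]
      change τ.1.min' τ.2.1 = _
      rw [← Finset.orderEmbOfFin_zero hτ (by omega)]
      congr 1; exact Fin.ext (by simp [hm])
    · rw [dif_neg (by omega)]
      change τ.1.orderEmbOfFin hτ ⟨a + m - a, _⟩ = _
      congr 1; exact Fin.ext (by simp)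
  rw [hfw, hbw]
  unfold SysCochain.crossRead
  rw [SysCochain.altEvalAt_of_strictMono _ (σ.1.orderEmbOfFin hσ).strictMono, Finset.image_orderEmbOfFin_univ,
    SysCochain.altEvalAt_of_strictMono _ (τ.1.orderEmbOfFin hτ).strictMono, Finset.image_orderEmbOfFin_univ,
    SysCochain.ext0At_self (M := cochainSystem P a) x τ]
  exact SysCochain.ext0At_self (M := P.flip.obj τ.1) (x τ) σ

/-! ### §3 The shuffle map after the cross product: componentwise -/

variable (P)

/-- **`∇_{a,b} (×_{a,b} x) = x`** (natural-number degrees): along `T ⊆ σ × τ` only the staircase survives, with coefficient `1` and reading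
`x(τ)(σ)`. [cite: EilenbergMacLane1953, §5] [cite: StacksProject, Tag 0BEC] -/
theorem shuffleComponent_crossComponent_nat (a b : ℕ) (x : SysCochain (cochainSystem P a) b) :
    shuffleComponent P ((a : ℤ) + b) a b (crossComponent P a b ((a : ℤ) + b) x) = x := by
  funext τ σ
  rw [shuffleComponent_apply]
  rw [Finset.sum_eq_single (((σ.1 ×ˢ ({τ.1.min' τ.2.1} : Finset κ)) ∪ (({σ.1.max' σ.2.1} : Finset ι) ×ˢ τ.1)).image toLex)]
  · have hS : ∀ j ∈ τ.1, toLex (σ.1.max' σ.2.1, j) ∈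
        ((σ.1 ×ˢ ({τ.1.min' τ.2.1} : Finset κ)) ∪ (({σ.1.max' σ.2.1} : Finset ι) ×ˢ τ.1)).image toLex :=
      fun j hj => mem_staircase.mpr (Or.inr ⟨rfl, hj⟩)
    rw [boxEval_crossComponent_staircase, shuffleCoeff_eq_ite_of_column σ.2.1 τ.2.1 hS, if_pos rfl, Int.cast_one, one_smul]
  · -- every other `T` contributes `0`
    intro T hT hne
    have hT' := subset_image_toLex_iff.mp (Finset.mem_powerset.mp hT)
    by_cases hc : T.card = a + b + 1
    swap
    · rw [boxEval_crossComponent_of_card_ne a b x _ _ hc, smul_zero]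
    rw [boxEval_crossComponent a b x _ _ hT' hc]
    by_cases h0 : x.crossRead (frontWord T hc) (backWord T hc) σ.1 τ.1 = 0
    · rw [h0, smul_zero]
    · rw [shuffleCoeff_eq_ite_of_column σ.2.1 τ.2.1 (column_subset_of_crossRead_ne_zero a b x σ τ hT' hc h0).1, if_neg hne,
        Int.cast_zero, zero_smul]
  · intro h
    exact absurd (Finset.mem_powerset.mpr (subset_image_toLex_iff.mpr (staircase_subset_box σ.1 τ.1 σ.2.1 τ.2.1))) h

/-- **`∇_{a',b'} (×_{a,b} x) = 0` for `(a', b') ≠ (a, b)` of the same total degree** (natural-number degrees): a surviving reading would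
need `a + 1` distinct first letters inside the `a'`-simplex `σ` and `b + 1` distinct second letters inside the `b'`-simplex `τ`.
[cite: EilenbergMacLane1953, §5] [cite: StacksProject, Tag 0BEC] -/
theorem shuffleComponent_crossComponent_nat_of_ne (a b : ℕ) {a' b' : ℤ} (hab : a' + b' = (a : ℤ) + b) (hne : a' ≠ a)
    (x : SysCochain (cochainSystem P a) b) :
    shuffleComponent P ((a : ℤ) + b) a' b' (crossComponent P a b ((a : ℤ) + b) x) = 0 := by
  funext τ σ
  rw [shuffleComponent_apply]
  refine Finset.sum_eq_zero fun T hT => ?_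
  have hT' := subset_image_toLex_iff.mp (Finset.mem_powerset.mp hT)
  by_cases hc : T.card = a + b + 1
  swap
  · rw [boxEval_crossComponent_of_card_ne a b x _ _ hc, smul_zero]
  rw [boxEval_crossComponent a b x _ _ hT' hc]
  by_cases h0 : x.crossRead (frontWord T hc) (backWord T hc) σ.1 τ.1 = 0
  · rw [h0, smul_zero]
  · exfalso
    obtain ⟨-, -, ⟨-, hαc⟩, hαs, ⟨-, hβc⟩, hβt⟩ := crossRead_ne_zero_imp x _ _ _ _ h0
    have h1 := Finset.card_le_card hαs
    have h2 := Finset.card_le_card hβt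
    have h3 := σ.2.2
    have h4 := τ.2.2
    omega

/-- **`∇_{a, n-a} ∘ ×_{a, n-a} = 𝟙`** (integer degrees). [cite: EilenbergMacLane1953, §5] [cite: StacksProject, Tag 0BEC] -/
theorem shuffleComponent_comp_crossComponent_self (n a : ℤ) :
    shuffleComponent P n a (n - a) ∘ₗ crossComponent P a (n - a) n = LinearMap.id := by
  rcases lt_or_ge a 0 with ha | ha
  · haveI : IsEmpty (Simplex ι a) := isEmpty_simplex_of_neg ha
    haveI := subsingleton_sysCochain_cochainSystem P (a := a) (n - a)
    exact LinearMap.ext fun x => Subsingleton.elim _ _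
  rcases lt_or_ge (n - a) 0 with hb | hb
  · haveI : IsEmpty (Simplex κ (n - a)) := isEmpty_simplex_of_neg hb
    exact LinearMap.ext fun x => Subsingleton.elim (α := SysCochain (cochainSystem P a) (n - a)) _ _
  obtain ⟨a₀, rfl⟩ := Int.eq_ofNat_of_zero_le ha
  obtain ⟨b₀, hb₀⟩ := Int.eq_ofNat_of_zero_le hb
  obtain rfl : n = (a₀ : ℤ) + b₀ := by omega
  rw [show (a₀ : ℤ) + b₀ - a₀ = b₀ by omega]
  exact LinearMap.ext fun x => shuffleComponent_crossComponent_nat P a₀ b₀ x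

/-- **`∇_{a', n-a'} ∘ ×_{a, n-a} = 0` for `a' ≠ a`** (integer degrees). [cite: EilenbergMacLane1953, §5] [cite: StacksProject, Tag 0BEC] -/
theorem shuffleComponent_comp_crossComponent_of_ne (n a a' : ℤ) (hne : a' ≠ a) :
    shuffleComponent P n a' (n - a') ∘ₗ crossComponent P a (n - a) n = 0 := by
  by_cases hr : 0 ≤ a ∧ 0 ≤ n - a ∧ a + (n - a) = n
  swap
  · rw [crossComponent_of_not P hr, LinearMap.comp_zero]
  obtain ⟨a₀, rfl⟩ := Int.eq_ofNat_of_zero_le hr.1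
  obtain ⟨b₀, hb₀⟩ := Int.eq_ofNat_of_zero_le hr.2.1
  obtain rfl : n = (a₀ : ℤ) + b₀ := by omega
  rw [show (a₀ : ℤ) + b₀ - a₀ = b₀ by omega]
  exact LinearMap.ext fun x => shuffleComponent_crossComponent_nat_of_ne P a₀ b₀ (by omega) hne x

/-! ### §4 `× ≫ ∇ = 𝟙` on the total complex -/

/-- **The Eilenberg–Zilber retraction**: on the total complex of the ordered Čech bicomplex of a pair-system, the cross product followed
by the shuffle map is the identity, `× ≫ ∇ = 𝟙 (Tot Č•,•(P))`. [cite: EilenbergMacLane1953, §5] [cite: StacksProject, Tag 0BEC] -/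
theorem cross_shuffle :
    totalDescHom (sysBicomplex P) (sysComplex (lexSystem P)) (fun a b n => ModuleCat.ofHom (crossComponent P a b n))
        (crossComponent_comm P) ≫
      totalLift (sysBicomplex P) (sysComplex (lexSystem P)) (isZero_sysBicomplex_X_X_of_neg_left P)
        (isZero_sysBicomplex_X_X_of_neg_right P) (fun n a b => ModuleCat.ofHom (shuffleComponent P n a b))
        (shuffleComponent_comm P) =
      𝟙 _ := by
  refine HomologicalComplex.hom_ext _ _ fun n => ?_
  refine HomologicalComplex₂.total.hom_ext (ComplexShape.up ℤ) fun a b hab => ?_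
  rw [π_up_int] at hab
  obtain rfl : b = n - a := by omega
  rw [HomologicalComplex.comp_f, HomologicalComplex.id_f, Category.comp_id, ← Category.assoc, ιTotal_totalDescHom_f,
    totalLift_f]
  unfold totalLiftF
  rw [Preadditive.comp_sum]
  by_cases ha : a ∈ Finset.Icc (0 : ℤ) n
  · rw [Finset.sum_eq_single a]
    · rw [← Category.assoc, ← ModuleCat.ofHom_comp, shuffleComponent_comp_crossComponent_self, ModuleCat.ofHom_id]
      exact Category.id_comp _
    · intro a' _ hne
      rw [← Category.assoc, ← ModuleCat.ofHom_comp, shuffleComponent_comp_crossComponent_of_ne P n a a' hne,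
        ModuleCat.ofHom_zero, zero_comp]
    · intro h; exact absurd ha h
  · -- `(a, n - a)` outside the first quadrant: the source is zero
    have hz : IsZero (((sysBicomplex P).X a).X (n - a)) := by
      rcases lt_or_ge a 0 with h | h
      · exact isZero_sysBicomplex_X_X_of_neg_left P a _ h
      · exact isZero_sysBicomplex_X_X_of_neg_right P a _ (by simp only [Finset.mem_Icc, not_and, not_le] at ha; omega)
    exact hz.eq_of_src _ _

end OrderedCech

end Literature.Algebra.Homology

end
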